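import Literature.MathematicalPhysics.QuantumFieldTheory.Balaban1983to89.T4DilationKPLog
import Summits.QuantumFields.BalabanUV.T4Continuum.Spine.NE7.Targets

/-!
# YM-DAG node N19 (= NE7 proper) — THE MIXING LETTER (MIX) FROM TWO-HOLE DECOUPLING OF A KOTECKÝ–PREISS GAS: the inclusion–exclusion identity
# `log Z(Λ) − log Z(Λ∖H₁) − log Z(Λ∖H₂) + log Z(Λ∖(H₁∪H₂)) = Σ_{C ⊆ Λ meeting H₁ AND H₂} Φ^T(C)` (no smallness), its Kotecký–Preiss bound
# `≤ e^{−D}·Σ_{H₁} a` when every cluster joining the two holes has decay weight `≥ D`, and the class-gas face: with old holes `H₁(τ₁)`, recent holes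
# `H₂(τ₂)` and multiplicative prefactors, the source-free class law is a QUASI-PRODUCT — FILE G's (MIX) with `s∕2 = e^{−D}·Σ_{H₁} a` — and the companion
# (LOC) letter from HOLE–SOURCE decoupling: the loop's response does not read the old holes, `s' = 2e^{−D'}·Σ_{H₁} a`

Cell `pub-ymgap`, HUMAN RULING D-0062 (Track A), width seat `pub-ymgap-dag-n19-w2` (node n19 = NE7), generation g7 (R455 (A) rule (ii); CLAIM-6 on the cell
bus).  Route `Summits/QuantumFields/YangMills/Theses/BalabanUVNodes.lean`, key item K3⁸ `SpineGivenEndpointR13SepCoPHV` (stmt-QuantumFields-27366; aside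
predecessor K3⁷ 20544); filed `--kind proof --supports … --as helper`.  COUNT-NEUTRAL.  THEOREMS ONLY (0 `def`, 0 `sorry`).  Imports the tree's
`Literature.…Balaban1983to89.T4DilationKPLog` (`sum_truncatedWeight_meet_eq`; through it `T4ActivityLipschitz.sum_norm_truncatedWeight_le_of_pin` — the
finite-volume Kotecký–Preiss estimate (4) with decay — and `Literature.Probability.LatticeModels.*`: `polymerLogZ`, `truncatedWeight`,
`truncatedWeight_eq_zero_of_kp`, `polymerLogZ_eq_log_of_real`, `isKPVolume_of_kpd`) and `Spine/NE7/Targets`; every cluster-expansion fact BY NAME.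

WHERE THIS SITS.  FILE G (`…N19AgingLetterOfMixingLocality`, CLAIM-5): node U5's `Target` ⇐ (RM) + (MIX) + (LOC), with (MIX) = «run A's source-free class
law is a QUASI-PRODUCT of its old and recent coordinates: `|log A_0(τ₁,τ₂) − log(a₁ τ₁ · μ τ₂)| ≤ s∕2`».  In the class-gas reading of FILES A∕B∕E a class is
a large-field configuration EXCLUDED from the small-field gas: class `(τ₁, τ₂)` = old holes `H₁(τ₁)` and recent holes `H₂(τ₂)` cut out of a common volume `Λ`,
weight `A_0 = F₁(τ₁)·F₂(τ₂)·Z(Λ ∖ (H₁ ∪ H₂))` (block factors multiplicative over disjoint regions).  Then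
`log A_0 − log(F₁ Z(Λ∖H₁)) − log(F₂ Z(Λ∖H₂)∕Z(Λ)) = log Z(Λ∖(H₁∪H₂)) − log Z(Λ∖H₁) − log Z(Λ∖H₂) + log Z(Λ)` = THE TWO-HOLE INTERACTION, which the cluster
expansion writes as the sum of `Φ^T(C)` over the clusters meeting BOTH holes (§1, Möbius inversion only) and the Kotecký–Preiss estimate bounds by
`e^{−D}·Σ_{γ∈H₁} a γ` as soon as every cluster joining the holes carries decay weight `Σ_C d ≥ D` (§2) — `D` = the `d`-distance between old and recent
structure.  So (MIX) holds with `a₁(τ₁) = F₁ Z(Λ∖H₁)`, `μ(τ₂) = F₂ Z(Λ∖H₂)∕Z(Λ)` and `s∕2 = e^{−D}·Σ_{H₁} a` (§3): MIXING ACROSS SCALES = CLUSTER DECAY BETWEEN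
THE OLD AND THE RECENT HOLES.  (In Bałaban's setting old UV-scale holes may sit spatially AT the loop; the decay weight `d` that separates them from recent
unit-scale structure is then an AGE weight, not a distance — the (1.99)∕(1.100) `e^{−p₀(g_k)}`-type smallness of old remnants; a reading question, not settled here.)

WHAT IS KERNEL-CHECKED ([folklore] over the tree's KP library BY NAME).
* §1 `sum_truncatedWeight_meetBoth_eq` — for ANY activities and ANY `H₁, H₂`: `Σ_{C ⊆ Λ, C∩H₁ ≠ ∅, C∩H₂ ≠ ∅} Φ^T(C) = log Z(Λ) − log Z(Λ∖H₁) − log Z(Λ∖H₂) +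
  log Z(Λ∖(H₁∪H₂))` (twice `sum_truncatedWeight_meet_eq`; no smallness, no disjointness).
* §2 ★ `norm_twoHole_le` — hypothesis (1) with weights `(a, d)` on `Λ`, `H₁ ⊆ Λ`, and the SEPARATION clause «every cluster `C ⊆ Λ` meeting `H₁` and `H₂` has
  `D ≤ Σ_{γ∈C} d γ`» ⇒ `‖log Z(Λ) − log Z(Λ∖H₁) − log Z(Λ∖H₂) + log Z(Λ∖(H₁∪H₂))‖ ≤ e^{−D}·Σ_{γ∈H₁} a γ` (pin each joining cluster at a polymer of `H₁`; non-clusters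
  vanish by `truncatedWeight_eq_zero_of_kp`; the tree's `sum_norm_truncatedWeight_le_of_pin`).
* §3 ★ `quasiProduct_of_twoHole` — REAL activities: the four partition functions are positive reals and, with positive prefactors `F₁, F₂`,
  `|log(F₁F₂·Z(Λ∖(H₁∪H₂)).re) − log((F₁·Z(Λ∖H₁).re)·(F₂·Z(Λ∖H₂).re∕Z(Λ).re))| ≤ e^{−D}·Σ_{H₁} a` — FILE G's (MIX) letter for one class pair, with `a₁ = F₁·Z(Λ∖H₁)`,
  `μ = F₂·Z(Λ∖H₂)∕Z(Λ)`.
* §5 THE COMPANION (LOC) LETTER — `incr_sub_incr_sdiff_eq_sum_meetBoth` (hole × SOURCE inclusion–exclusion for two source values agreeing off `S`: the old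
  hole changes the source increment only through clusters joining it to `S`; no smallness), ★★ `norm_holeSource_le` (`≤ 2e^{−D}·Σ_{H₁} a` when every
  cluster joining `H₁` to `S` has decay `≥ D`), ★ `localResponse_of_holeSource` (REAL activities: `|log A_t − log A_0 − log ρ̄_t| ≤ 2e^{−D}Σ_{H₁} a` with the
  OLD-HOLE-FREE response `ρ̄_t = Z(Λ∖H₂; w^t)∕Z(Λ∖H₂; w^0)` — FILE G's `hLOC` for the class pair): LOCALITY OF THE LOOP RESPONSE = CLUSTER DECAY BETWEEN THE
  OLD HOLES AND THE SOURCE SUPPORT.  With §3, BOTH one-run letters of G come from cluster decay away from the old holes.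
* §4 SANITY (A6): disjointly supported holes with no joining cluster at all (`H₂ = ∅`) — the interaction vanishes identically (`example`).

HONEST FRAMING.  Classical cluster-expansion bookkeeping on HYPOTHESIS SHAPES: the class-gas reading with multiplicative block factors, hypothesis (1) with a
decay weight, and the separation `D` between old and recent holes are BINDERS produced by nobody for Bałaban's runs ([LF-II] (1.98)–(1.100) is the printed
ONE-run format; the age∕distance reading of `d` is a modelling question); ZERO Bałaban content; NE7 NOT PRINTED for d = 4 ∕ NOT proved; N19 NOT discharged;
K3⁸ 27366 OPEN, not claimed — stub 2 is `Core`-typed and NOT served here; counts UNMOVED (typed 28∕28 · discharged 5∕27, A 5∕28); no count claim.  One finite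
four-torus programme at fixed ε; R4 closes the conditional finite-𝕋⁴ rung `BalabanLadder.UV` only — NOT infinite volume, NOT OS on ℝ⁴, NOT the Yang–Mills mass
gap, NOT the Clay problem.  0 `def`; 0 `sorry`; standard axioms.
-/

noncomputable section

open Finset
open scoped BigOperators

namespace Summit.QuantumFields.YangMills.BalabanUVNodes.N19MixingLetterOfTwoHoleDecoupling

open Literature.Probability.LatticeModels
open Literature.MathematicalPhysics.QuantumFieldTheory.Balaban1983to89.T4DilationKPLog (sum_truncatedWeight_meet_eq)
open Literature.MathematicalPhysics.QuantumFieldTheory.Balaban1983to89.T4ActivityLipschitz (sum_norm_truncatedWeight_le_of_pin)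

variable {P : Type*} [DecidableEq P] {inc : P → P → Prop} [DecidableRel inc]

/-! ## §1 The two-hole interaction is the sum over clusters meeting both holes (Möbius inversion only) -/

/-- **TWO-HOLE INCLUSION–EXCLUSION.**  For any activities `w`, any volume `Λ` and any `H₁, H₂`:
`Σ_{C ⊆ Λ, C ∩ H₁ ≠ ∅ ∧ C ∩ H₂ ≠ ∅} Φ^T(C) = log Z(Λ) − log Z(Λ ∖ H₁) − log Z(Λ ∖ H₂) + log Z(Λ ∖ (H₁ ∪ H₂))` — the clusters through BOTH holes carry the whole
interaction of the two exclusions.  No smallness, no disjointness (`sum_truncatedWeight_meet_eq` on `Λ` and on `Λ ∖ H₁`). [folklore] -/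
theorem sum_truncatedWeight_meetBoth_eq (w : P → ℂ) (Λ H₁ H₂ : Finset P) :
    ∑ C ∈ Λ.powerset with ((C ∩ H₁).Nonempty ∧ (C ∩ H₂).Nonempty), truncatedWeight inc w C =
      polymerLogZ inc w Λ - polymerLogZ inc w (Λ \ H₁) - polymerLogZ inc w (Λ \ H₂) + polymerLogZ inc w (Λ \ (H₁ ∪ H₂)) := by
  -- clusters of `Λ` meeting `H₂`, split by whether they meet `H₁`
  have hΛ := sum_truncatedWeight_meet_eq (inc := inc) w Λ H₂
  have hΛ₁ := sum_truncatedWeight_meet_eq (inc := inc) w (Λ \ H₁) H₂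
  rw [sdiff_sdiff_left, Finset.sup_eq_union] at hΛ₁
  -- `{C ⊆ Λ : meets H₂} = {meets H₁ ∧ meets H₂} ⊔ {C ⊆ Λ∖H₁ : meets H₂}`
  have hsplit : ∑ C ∈ Λ.powerset with (C ∩ H₂).Nonempty, truncatedWeight inc w C =
      (∑ C ∈ Λ.powerset with ((C ∩ H₁).Nonempty ∧ (C ∩ H₂).Nonempty), truncatedWeight inc w C) +
        ∑ C ∈ (Λ \ H₁).powerset with (C ∩ H₂).Nonempty, truncatedWeight inc w C := by
    rw [← Finset.sum_filter_add_sum_filter_not (Λ.powerset.filter fun C => (C ∩ H₂).Nonempty) (fun C => (C ∩ H₁).Nonempty)]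
    congr 1
    · rw [Finset.filter_filter]
      exact Finset.sum_congr (Finset.filter_congr fun C _ => by tauto) fun _ _ => rfl
    · refine Finset.sum_congr ?_ fun _ _ => rfl
      ext C
      simp only [Finset.mem_filter, Finset.mem_powerset, Finset.not_nonempty_iff_eq_empty, Finset.subset_sdiff,
        Finset.disjoint_iff_inter_eq_empty]
      tauto
  rw [hsplit, hΛ₁] at hΛ
  linear_combination hΛ

/-! ## §2 The Kotecký–Preiss bound: clusters joining separated holes are exponentially small -/

variable [Std.Refl inc] [Std.Symm inc]

/-- **TWO-HOLE DECOUPLING BOUND.**  Hypothesis (1) with weights `(a, d)`, `a, d ≥ 0`, on `Λ`; `H₁ ⊆ Λ`; SEPARATION: every cluster `C ⊆ Λ` meeting `H₁` and `H₂`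
has `D ≤ Σ_{γ∈C} d γ`.  Then `‖log Z(Λ) − log Z(Λ∖H₁) − log Z(Λ∖H₂) + log Z(Λ∖(H₁∪H₂))‖ ≤ e^{−D}·Σ_{γ∈H₁} a γ` — pin every joining cluster at a polymer of `H₁`
(overcounting allowed: all terms are non-negative), drop non-clusters (`truncatedWeight_eq_zero_of_kp`), and apply the tree's pinned estimate (4) with decay
(`T4ActivityLipschitz.sum_norm_truncatedWeight_le_of_pin`). [folklore] -/
theorem norm_twoHole_le {w : P → ℂ} {a d : P → ℝ} (ha : ∀ γ, 0 ≤ a γ) (hd : ∀ γ, 0 ≤ d γ) {Λ H₁ H₂ : Finset P}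
    (h1 : ∀ γ ∈ Λ, ∑ γ' ∈ Λ with inc γ' γ, ‖w γ'‖ * Real.exp (a γ' + d γ') ≤ a γ) (hH₁ : H₁ ⊆ Λ) {D : ℝ}
    (hsep : ∀ C ⊆ Λ, IsPolymerCluster inc C → (C ∩ H₁).Nonempty → (C ∩ H₂).Nonempty → D ≤ ∑ γ ∈ C, d γ) :
    ‖polymerLogZ inc w Λ - polymerLogZ inc w (Λ \ H₁) - polymerLogZ inc w (Λ \ H₂) + polymerLogZ inc w (Λ \ (H₁ ∪ H₂))‖ ≤
      Real.exp (-D) * ∑ γ ∈ H₁, a γ := by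
  classical
  have hKP : IsKPVolume inc w a Λ := isKPVolume_of_kpd hd h1
  rw [← sum_truncatedWeight_meetBoth_eq]
  -- keep only clusters (non-clusters have `Φ^T = 0`)
  set 𝒞 : Finset (Finset P) := (Λ.powerset.filter fun C => (C ∩ H₁).Nonempty ∧ (C ∩ H₂).Nonempty).filter
    fun C => IsPolymerCluster inc C with h𝒞
  have hrestrict : ∑ C ∈ 𝒞, truncatedWeight inc w C =
      ∑ C ∈ Λ.powerset with ((C ∩ H₁).Nonempty ∧ (C ∩ H₂).Nonempty), truncatedWeight inc w C := by
    rw [h𝒞]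
    refine Finset.sum_filter_of_ne fun C hC hne => ?_
    by_contra hcl
    exact hne (truncatedWeight_eq_zero_of_kp hKP (Finset.mem_powerset.1 (Finset.mem_filter.1 hC).1) hcl)
  rw [← hrestrict]
  -- every cluster of `𝒞` contains a polymer of `H₁`
  have hcover : ∀ C ∈ 𝒞, ∃ γ ∈ H₁, γ ∈ C := by
    intro C hC
    have hC1 := (Finset.mem_filter.1 hC).1
    obtain ⟨γ, hγ⟩ := (Finset.mem_filter.1 hC1).2.1
    exact ⟨γ, (Finset.mem_inter.1 hγ).2, (Finset.mem_inter.1 hγ).1⟩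
  have hmemΛ : ∀ C ∈ 𝒞, C ⊆ Λ := fun C hC => Finset.mem_powerset.1 (Finset.mem_filter.1 (Finset.mem_filter.1 hC).1).1
  calc ‖∑ C ∈ 𝒞, truncatedWeight inc w C‖
      ≤ ∑ C ∈ 𝒞, ‖truncatedWeight inc w C‖ := norm_sum_le _ _
    _ ≤ ∑ C ∈ 𝒞, ∑ γ ∈ H₁, (if γ ∈ C then ‖truncatedWeight inc w C‖ else 0) := by
        refine Finset.sum_le_sum fun C hC => ?_
        obtain ⟨γ, hγH, hγC⟩ := hcover C hC
        have := Finset.single_le_sum (f := fun γ' => if γ' ∈ C then ‖truncatedWeight inc w C‖ else 0)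
          (fun γ' _ => by split_ifs <;> first | exact norm_nonneg _ | exact le_rfl) hγH
        simpa [hγC] using this
    _ = ∑ γ ∈ H₁, ∑ C ∈ 𝒞, (if γ ∈ C then ‖truncatedWeight inc w C‖ else 0) := Finset.sum_comm
    _ = ∑ γ ∈ H₁, ∑ C ∈ 𝒞 with γ ∈ C, ‖truncatedWeight inc w C‖ :=
        Finset.sum_congr rfl fun γ _ => (Finset.sum_filter _ _).symm
    _ ≤ ∑ γ ∈ H₁, a γ * Real.exp (-D) := by
        refine Finset.sum_le_sum fun γ hγ => ?_
        refine sum_norm_truncatedWeight_le_of_pin ha hd h1 (hH₁ hγ) (fun C hC => hmemΛ C (Finset.mem_filter.1 hC).1)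
          (fun C hC => ⟨γ, (Finset.mem_filter.1 hC).2, Std.Refl.refl γ⟩) fun C hC => ?_
        have hC𝒞 := (Finset.mem_filter.1 hC).1
        have hcl := (Finset.mem_filter.1 hC𝒞).2
        obtain ⟨hCΛ, hm1, hm2⟩ := Finset.mem_filter.1 (Finset.mem_filter.1 hC𝒞).1
        exact hsep C (Finset.mem_powerset.1 hCΛ) hcl hm1 hm2
    _ = Real.exp (-D) * ∑ γ ∈ H₁, a γ := by rw [Finset.mul_sum]; exact Finset.sum_congr rfl fun _ _ => mul_comm _ _

/-! ## §3 The class-gas face: old holes × recent holes with multiplicative prefactors ⇒ FILE G's (MIX) letter -/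

/-- **THE QUASI-PRODUCT (MIX) LETTER OF ONE CLASS PAIR FROM TWO-HOLE DECOUPLING.**  REAL activities obeying (1) with `(a, d)` on `Λ` (so `Z(Λ')` is a positive
real for every `Λ' ⊆ Λ`), old holes `H₁ ⊆ Λ`, recent holes `H₂`, separation `D` as in `norm_twoHole_le`, positive prefactors `F₁` (old block factor) and `F₂`
(recent block factor).  Then the source-free class weight `A_0 = F₁·F₂·Z(Λ∖(H₁∪H₂)).re` is within `e^{−D}·Σ_{H₁} a` (in log) of the PRODUCT
`(F₁·Z(Λ∖H₁).re)·(F₂·Z(Λ∖H₂).re ∕ Z(Λ).re)` — FILE G's hypothesis `hMIX` for this class pair with `a₁ := F₁·Z(Λ∖H₁).re`, `μ := F₂·Z(Λ∖H₂).re∕Z(Λ).re`. [folklore] -/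
theorem quasiProduct_of_twoHole {w : P → ℂ} {a d : P → ℝ} (ha : ∀ γ, 0 ≤ a γ) (hd : ∀ γ, 0 ≤ d γ) {Λ H₁ H₂ : Finset P}
    (h1 : ∀ γ ∈ Λ, ∑ γ' ∈ Λ with inc γ' γ, ‖w γ'‖ * Real.exp (a γ' + d γ') ≤ a γ) (hw : ∀ γ, (w γ).im = 0) (hH₁ : H₁ ⊆ Λ) {D : ℝ}
    (hsep : ∀ C ⊆ Λ, IsPolymerCluster inc C → (C ∩ H₁).Nonempty → (C ∩ H₂).Nonempty → D ≤ ∑ γ ∈ C, d γ) {F₁ F₂ : ℝ} (hF₁ : 0 < F₁)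
    (hF₂ : 0 < F₂) :
    0 < (polymerPartitionFunction inc w Λ).re ∧ 0 < (polymerPartitionFunction inc w (Λ \ H₁)).re ∧
    0 < (polymerPartitionFunction inc w (Λ \ H₂)).re ∧ 0 < (polymerPartitionFunction inc w (Λ \ (H₁ ∪ H₂))).re ∧
    |Real.log (F₁ * F₂ * (polymerPartitionFunction inc w (Λ \ (H₁ ∪ H₂))).re) -
        Real.log ((F₁ * (polymerPartitionFunction inc w (Λ \ H₁)).re) *
          (F₂ * (polymerPartitionFunction inc w (Λ \ H₂)).re / (polymerPartitionFunction inc w Λ).re))| ≤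
      Real.exp (-D) * ∑ γ ∈ H₁, a γ := by
  have hKP : IsKPVolume inc w a Λ := isKPVolume_of_kpd hd h1
  -- real logarithms of the four partition functions
  have hlog : ∀ Λ' ⊆ Λ, 0 < (polymerPartitionFunction inc w Λ').re ∧
      polymerLogZ inc w Λ' = (Real.log (polymerPartitionFunction inc w Λ').re : ℂ) := fun Λ' hΛ' =>
    polymerLogZ_eq_log_of_real (inc := inc) hw (B := Λ') fun t ht => polymerPartitionFunction_ne_zero_of_kp (hKP.ray ht) hΛ'
  obtain ⟨p0, e0⟩ := hlog Λ le_rfl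
  obtain ⟨p1, e1⟩ := hlog (Λ \ H₁) Finset.sdiff_subset
  obtain ⟨p2, e2⟩ := hlog (Λ \ H₂) Finset.sdiff_subset
  obtain ⟨p12, e12⟩ := hlog (Λ \ (H₁ ∪ H₂)) Finset.sdiff_subset
  refine ⟨p0, p1, p2, p12, ?_⟩
  have h := norm_twoHole_le ha hd h1 hH₁ (H₂ := H₂) hsep
  rw [e0, e1, e2, e12] at h
  have hre : ‖(Real.log (polymerPartitionFunction inc w Λ).re : ℂ) - (Real.log (polymerPartitionFunction inc w (Λ \ H₁)).re : ℂ) -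
        (Real.log (polymerPartitionFunction inc w (Λ \ H₂)).re : ℂ) + (Real.log (polymerPartitionFunction inc w (Λ \ (H₁ ∪ H₂))).re : ℂ)‖ =
      |Real.log (polymerPartitionFunction inc w Λ).re - Real.log (polymerPartitionFunction inc w (Λ \ H₁)).re -
        Real.log (polymerPartitionFunction inc w (Λ \ H₂)).re + Real.log (polymerPartitionFunction inc w (Λ \ (H₁ ∪ H₂))).re| := by
    rw [← Complex.ofReal_sub, ← Complex.ofReal_sub, ← Complex.ofReal_add, Complex.norm_real, Real.norm_eq_abs]
  rw [hre] at h
  -- expand the logarithms of the products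
  rw [Real.log_mul (mul_pos hF₁ hF₂).ne' p12.ne', Real.log_mul hF₁.ne' hF₂.ne',
    Real.log_mul (mul_pos hF₁ p1).ne' (div_pos (mul_pos hF₂ p2) p0).ne', Real.log_mul hF₁.ne' p1.ne',
    Real.log_div (mul_pos hF₂ p2).ne' p0.ne', Real.log_mul hF₂.ne' p2.ne']
  have e : Real.log F₁ + Real.log F₂ + Real.log (polymerPartitionFunction inc w (Λ \ (H₁ ∪ H₂))).re -
      (Real.log F₁ + Real.log (polymerPartitionFunction inc w (Λ \ H₁)).re +
        (Real.log F₂ + Real.log (polymerPartitionFunction inc w (Λ \ H₂)).re - Real.log (polymerPartitionFunction inc w Λ).re)) =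
      Real.log (polymerPartitionFunction inc w Λ).re - Real.log (polymerPartitionFunction inc w (Λ \ H₁)).re -
        Real.log (polymerPartitionFunction inc w (Λ \ H₂)).re + Real.log (polymerPartitionFunction inc w (Λ \ (H₁ ∪ H₂))).re := by ring
  rw [e]
  exact h

/-! ## §5 The companion (LOC) letter: old holes decoupled from the SOURCE — the loop's response does not read the old coordinate -/

omit [Std.Refl inc] [Std.Symm inc] in
/-- **HOLE × SOURCE INCLUSION–EXCLUSION.**  Two activity families `w` (source `t`) and `w₀` (source `0`) agreeing on the volume `V` off the source support `S`;
a hole `H₁`.  Then `[log Z(V; w) − log Z(V; w₀)] − [log Z(V∖H₁; w) − log Z(V∖H₁; w₀)] = Σ_{C ⊆ V, C meets H₁ AND S} (Φ^T(C; w) − Φ^T(C; w₀))`: the old hole changes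
the source increment only through clusters joining it to the source (`sum_truncatedWeight_meet_eq` twice + `truncatedWeight_congr`; no smallness). [folklore] -/
theorem incr_sub_incr_sdiff_eq_sum_meetBoth {w w₀ : P → ℂ} {V H₁ S : Finset P} (hS : ∀ γ ∈ V, γ ∉ S → w γ = w₀ γ) :
    (polymerLogZ inc w V - polymerLogZ inc w₀ V) - (polymerLogZ inc w (V \ H₁) - polymerLogZ inc w₀ (V \ H₁)) =
      ∑ C ∈ V.powerset with ((C ∩ H₁).Nonempty ∧ (C ∩ S).Nonempty), (truncatedWeight inc w C - truncatedWeight inc w₀ C) := by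
  have h := sum_truncatedWeight_meet_eq (inc := inc) w V H₁
  have h₀ := sum_truncatedWeight_meet_eq (inc := inc) w₀ V H₁
  have hre : (polymerLogZ inc w V - polymerLogZ inc w₀ V) - (polymerLogZ inc w (V \ H₁) - polymerLogZ inc w₀ (V \ H₁)) =
      (polymerLogZ inc w V - polymerLogZ inc w (V \ H₁)) - (polymerLogZ inc w₀ V - polymerLogZ inc w₀ (V \ H₁)) := by ring
  rw [hre, ← h, ← h₀, ← Finset.sum_sub_distrib,
    ← Finset.sum_filter_add_sum_filter_not (V.powerset.filter fun C => (C ∩ H₁).Nonempty) (fun C => (C ∩ S).Nonempty)]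
  have hzero : ∑ C ∈ (V.powerset.filter fun C => (C ∩ H₁).Nonempty) with ¬ (C ∩ S).Nonempty,
      (truncatedWeight inc w C - truncatedWeight inc w₀ C) = 0 := by
    refine Finset.sum_eq_zero fun C hC => ?_
    obtain ⟨hC1, hCS⟩ := Finset.mem_filter.1 hC
    have hCV : C ⊆ V := Finset.mem_powerset.1 (Finset.mem_filter.1 hC1).1
    rw [Finset.not_nonempty_iff_eq_empty] at hCS
    rw [sub_eq_zero]
    refine truncatedWeight_congr fun γ hγ => hS γ (hCV hγ) fun hγS => ?_
    have : γ ∈ C ∩ S := Finset.mem_inter.2 ⟨hγ, hγS⟩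
    rw [hCS] at this
    exact Finset.notMem_empty γ this
  rw [hzero, add_zero, Finset.filter_filter]

/-- **HOLE–SOURCE DECOUPLING BOUND.**  Hypothesis (1) with `(a, d)` on `Λ ⊇ V` for BOTH `w` and `w₀`, `H₁ ⊆ Λ`, source locality on `V` off `S`, and SEPARATION
«every cluster `C ⊆ V` meeting `H₁` and `S` has `D ≤ Σ_C d`» ⇒ `‖[log Z(V;w) − log Z(V;w₀)] − [log Z(V∖H₁;w) − log Z(V∖H₁;w₀)]‖ ≤ 2·e^{−D}·Σ_{H₁} a`. [folklore] -/
theorem norm_holeSource_le {w w₀ : P → ℂ} {a d : P → ℝ} (ha : ∀ γ, 0 ≤ a γ) (hd : ∀ γ, 0 ≤ d γ) {Λ V H₁ S : Finset P} (hV : V ⊆ Λ)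
    (h1 : ∀ γ ∈ Λ, ∑ γ' ∈ Λ with inc γ' γ, ‖w γ'‖ * Real.exp (a γ' + d γ') ≤ a γ)
    (h1₀ : ∀ γ ∈ Λ, ∑ γ' ∈ Λ with inc γ' γ, ‖w₀ γ'‖ * Real.exp (a γ' + d γ') ≤ a γ) (hH₁ : H₁ ⊆ Λ)
    (hS : ∀ γ ∈ V, γ ∉ S → w γ = w₀ γ) {D : ℝ}
    (hsep : ∀ C ⊆ V, IsPolymerCluster inc C → (C ∩ H₁).Nonempty → (C ∩ S).Nonempty → D ≤ ∑ γ ∈ C, d γ) :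
    ‖(polymerLogZ inc w V - polymerLogZ inc w₀ V) - (polymerLogZ inc w (V \ H₁) - polymerLogZ inc w₀ (V \ H₁))‖ ≤
      2 * (Real.exp (-D) * ∑ γ ∈ H₁, a γ) := by
  classical
  rw [incr_sub_incr_sdiff_eq_sum_meetBoth hS, Finset.sum_sub_distrib]
  -- each of the two pinned sums is `≤ e^{−D} Σ_{H₁} a`
  have one : ∀ {u : P → ℂ}, (∀ γ ∈ Λ, ∑ γ' ∈ Λ with inc γ' γ, ‖u γ'‖ * Real.exp (a γ' + d γ') ≤ a γ) →
      ‖∑ C ∈ V.powerset with ((C ∩ H₁).Nonempty ∧ (C ∩ S).Nonempty), truncatedWeight inc u C‖ ≤ Real.exp (-D) * ∑ γ ∈ H₁, a γ := by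
    intro u hu
    have hKP : IsKPVolume inc u a Λ := isKPVolume_of_kpd hd hu
    set 𝒞 : Finset (Finset P) := (V.powerset.filter fun C => (C ∩ H₁).Nonempty ∧ (C ∩ S).Nonempty).filter
      fun C => IsPolymerCluster inc C with h𝒞
    have hrestrict : ∑ C ∈ 𝒞, truncatedWeight inc u C =
        ∑ C ∈ V.powerset with ((C ∩ H₁).Nonempty ∧ (C ∩ S).Nonempty), truncatedWeight inc u C := by
      rw [h𝒞]
      refine Finset.sum_filter_of_ne fun C hC hne => ?_
      by_contra hcl
      exact hne (truncatedWeight_eq_zero_of_kp hKP ((Finset.mem_powerset.1 (Finset.mem_filter.1 hC).1).trans hV) hcl)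
    rw [← hrestrict]
    have hcover : ∀ C ∈ 𝒞, ∃ γ ∈ H₁, γ ∈ C := by
      intro C hC
      obtain ⟨γ, hγ⟩ := (Finset.mem_filter.1 (Finset.mem_filter.1 hC).1).2.1
      exact ⟨γ, (Finset.mem_inter.1 hγ).2, (Finset.mem_inter.1 hγ).1⟩
    have hmemV : ∀ C ∈ 𝒞, C ⊆ V := fun C hC => Finset.mem_powerset.1 (Finset.mem_filter.1 (Finset.mem_filter.1 hC).1).1
    calc ‖∑ C ∈ 𝒞, truncatedWeight inc u C‖
        ≤ ∑ C ∈ 𝒞, ‖truncatedWeight inc u C‖ := norm_sum_le _ _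
      _ ≤ ∑ C ∈ 𝒞, ∑ γ ∈ H₁, (if γ ∈ C then ‖truncatedWeight inc u C‖ else 0) := by
          refine Finset.sum_le_sum fun C hC => ?_
          obtain ⟨γ, hγH, hγC⟩ := hcover C hC
          have := Finset.single_le_sum (f := fun γ' => if γ' ∈ C then ‖truncatedWeight inc u C‖ else 0)
            (fun γ' _ => by split_ifs <;> first | exact norm_nonneg _ | exact le_rfl) hγH
          simpa [hγC] using this
      _ = ∑ γ ∈ H₁, ∑ C ∈ 𝒞, (if γ ∈ C then ‖truncatedWeight inc u C‖ else 0) := Finset.sum_comm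
      _ = ∑ γ ∈ H₁, ∑ C ∈ 𝒞 with γ ∈ C, ‖truncatedWeight inc u C‖ := Finset.sum_congr rfl fun γ _ => (Finset.sum_filter _ _).symm
      _ ≤ ∑ γ ∈ H₁, a γ * Real.exp (-D) := by
          refine Finset.sum_le_sum fun γ hγ => ?_
          refine sum_norm_truncatedWeight_le_of_pin ha hd hu (hH₁ hγ) (fun C hC => (hmemV C (Finset.mem_filter.1 hC).1).trans hV)
            (fun C hC => ⟨γ, (Finset.mem_filter.1 hC).2, Std.Refl.refl γ⟩) fun C hC => ?_
          have hC𝒞 := (Finset.mem_filter.1 hC).1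
          have hcl := (Finset.mem_filter.1 hC𝒞).2
          obtain ⟨hCV, hm1, hm2⟩ := Finset.mem_filter.1 (Finset.mem_filter.1 hC𝒞).1
          exact hsep C (Finset.mem_powerset.1 hCV) hcl hm1 hm2
      _ = Real.exp (-D) * ∑ γ ∈ H₁, a γ := by rw [Finset.mul_sum]; exact Finset.sum_congr rfl fun _ _ => mul_comm _ _
  calc ‖(∑ C ∈ V.powerset with ((C ∩ H₁).Nonempty ∧ (C ∩ S).Nonempty), truncatedWeight inc w C) -
          ∑ C ∈ V.powerset with ((C ∩ H₁).Nonempty ∧ (C ∩ S).Nonempty), truncatedWeight inc w₀ C‖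
      ≤ ‖∑ C ∈ V.powerset with ((C ∩ H₁).Nonempty ∧ (C ∩ S).Nonempty), truncatedWeight inc w C‖ +
          ‖∑ C ∈ V.powerset with ((C ∩ H₁).Nonempty ∧ (C ∩ S).Nonempty), truncatedWeight inc w₀ C‖ := norm_sub_le _ _
    _ ≤ Real.exp (-D) * ∑ γ ∈ H₁, a γ + Real.exp (-D) * ∑ γ ∈ H₁, a γ := add_le_add (one h1) (one h1₀)
    _ = 2 * (Real.exp (-D) * ∑ γ ∈ H₁, a γ) := by ring

/-- **THE LOCAL-RESPONSE (LOC) LETTER OF ONE CLASS PAIR FROM HOLE–SOURCE DECOUPLING.**  REAL activities `w` (source `t`), `w₀` (source `0`) obeying (1) with `(a,d)`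
on `Λ`, source-local on `V := Λ ∖ H₂` off `S`; old holes `H₁ ⊆ Λ` separated from the source by `D`; source-free positive prefactors `F₁ F₂`.  Then the class
weights `A_s := F₁F₂·Z(Λ∖(H₁∪H₂); w_s).re` have `|log A_t − log A_0 − log ρ̄_t| ≤ 2e^{−D}·Σ_{H₁} a` with the OLD-HOLE-FREE response
`ρ̄_t := Z(Λ∖H₂; w).re ∕ Z(Λ∖H₂; w₀).re` — FILE G's hypothesis `hLOC` for this class pair: the loop does not read the old coordinate. [folklore] -/
theorem localResponse_of_holeSource {w w₀ : P → ℂ} {a d : P → ℝ} (ha : ∀ γ, 0 ≤ a γ) (hd : ∀ γ, 0 ≤ d γ) {Λ H₁ H₂ S : Finset P}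
    (h1 : ∀ γ ∈ Λ, ∑ γ' ∈ Λ with inc γ' γ, ‖w γ'‖ * Real.exp (a γ' + d γ') ≤ a γ)
    (h1₀ : ∀ γ ∈ Λ, ∑ γ' ∈ Λ with inc γ' γ, ‖w₀ γ'‖ * Real.exp (a γ' + d γ') ≤ a γ)
    (hw : ∀ γ, (w γ).im = 0) (hw₀ : ∀ γ, (w₀ γ).im = 0) (hH₁ : H₁ ⊆ Λ)
    (hS : ∀ γ ∈ Λ \ H₂, γ ∉ S → w γ = w₀ γ) {D : ℝ}
    (hsep : ∀ C ⊆ Λ \ H₂, IsPolymerCluster inc C → (C ∩ H₁).Nonempty → (C ∩ S).Nonempty → D ≤ ∑ γ ∈ C, d γ) {F₁ F₂ : ℝ} (hF₁ : 0 < F₁)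
    (hF₂ : 0 < F₂) :
    0 < (polymerPartitionFunction inc w (Λ \ H₂)).re ∧ 0 < (polymerPartitionFunction inc w₀ (Λ \ H₂)).re ∧
    0 < (polymerPartitionFunction inc w (Λ \ (H₁ ∪ H₂))).re ∧ 0 < (polymerPartitionFunction inc w₀ (Λ \ (H₁ ∪ H₂))).re ∧
    |Real.log (F₁ * F₂ * (polymerPartitionFunction inc w (Λ \ (H₁ ∪ H₂))).re) - Real.log (F₁ * F₂ * (polymerPartitionFunction inc w₀ (Λ \ (H₁ ∪ H₂))).re) -
        Real.log ((polymerPartitionFunction inc w (Λ \ H₂)).re / (polymerPartitionFunction inc w₀ (Λ \ H₂)).re)| ≤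
      2 * (Real.exp (-D) * ∑ γ ∈ H₁, a γ) := by
  have hKP : IsKPVolume inc w a Λ := isKPVolume_of_kpd hd h1
  have hKP₀ : IsKPVolume inc w₀ a Λ := isKPVolume_of_kpd hd h1₀
  have hlog : ∀ {u : P → ℂ}, IsKPVolume inc u a Λ → (∀ γ, (u γ).im = 0) → ∀ Λ' ⊆ Λ, 0 < (polymerPartitionFunction inc u Λ').re ∧
      polymerLogZ inc u Λ' = (Real.log (polymerPartitionFunction inc u Λ').re : ℂ) := fun hK hu Λ' hΛ' =>
    polymerLogZ_eq_log_of_real (inc := inc) hu (B := Λ') fun t ht => polymerPartitionFunction_ne_zero_of_kp (hK.ray ht) hΛ'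
  have hV12 : (Λ \ H₂) \ H₁ = Λ \ (H₁ ∪ H₂) := by rw [sdiff_sdiff_left, Finset.sup_eq_union, Finset.union_comm]
  obtain ⟨p2, e2⟩ := hlog hKP hw (Λ \ H₂) Finset.sdiff_subset
  obtain ⟨p2₀, e2₀⟩ := hlog hKP₀ hw₀ (Λ \ H₂) Finset.sdiff_subset
  obtain ⟨p12, e12⟩ := hlog hKP hw (Λ \ (H₁ ∪ H₂)) Finset.sdiff_subset
  obtain ⟨p12₀, e12₀⟩ := hlog hKP₀ hw₀ (Λ \ (H₁ ∪ H₂)) Finset.sdiff_subset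
  refine ⟨p2, p2₀, p12, p12₀, ?_⟩
  have h := norm_holeSource_le ha hd (Finset.sdiff_subset (s := Λ) (t := H₂)) h1 h1₀ hH₁ hS hsep
  rw [hV12, e2, e2₀, e12, e12₀] at h
  have hre : ‖((Real.log (polymerPartitionFunction inc w (Λ \ H₂)).re : ℂ) - (Real.log (polymerPartitionFunction inc w₀ (Λ \ H₂)).re : ℂ)) -
        ((Real.log (polymerPartitionFunction inc w (Λ \ (H₁ ∪ H₂))).re : ℂ) - (Real.log (polymerPartitionFunction inc w₀ (Λ \ (H₁ ∪ H₂))).re : ℂ))‖ =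
      |(Real.log (polymerPartitionFunction inc w (Λ \ H₂)).re - Real.log (polymerPartitionFunction inc w₀ (Λ \ H₂)).re) -
        (Real.log (polymerPartitionFunction inc w (Λ \ (H₁ ∪ H₂))).re - Real.log (polymerPartitionFunction inc w₀ (Λ \ (H₁ ∪ H₂))).re)| := by
    rw [← Complex.ofReal_sub, ← Complex.ofReal_sub, ← Complex.ofReal_sub, Complex.norm_real, Real.norm_eq_abs]
  rw [hre] at h
  rw [Real.log_mul (mul_pos hF₁ hF₂).ne' p12.ne', Real.log_mul (mul_pos hF₁ hF₂).ne' p12₀.ne', Real.log_div p2.ne' p2₀.ne']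
  have e : Real.log (F₁ * F₂) + Real.log (polymerPartitionFunction inc w (Λ \ (H₁ ∪ H₂))).re -
      (Real.log (F₁ * F₂) + Real.log (polymerPartitionFunction inc w₀ (Λ \ (H₁ ∪ H₂))).re) -
      (Real.log (polymerPartitionFunction inc w (Λ \ H₂)).re - Real.log (polymerPartitionFunction inc w₀ (Λ \ H₂)).re) =
      -((Real.log (polymerPartitionFunction inc w (Λ \ H₂)).re - Real.log (polymerPartitionFunction inc w₀ (Λ \ H₂)).re) -
        (Real.log (polymerPartitionFunction inc w (Λ \ (H₁ ∪ H₂))).re - Real.log (polymerPartitionFunction inc w₀ (Λ \ (H₁ ∪ H₂))).re)) := by ring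
  rw [e, abs_neg]
  exact h

/-! ## §4 Sanity: no recent hole, no interaction (content-free) -/

/-- SANITY (A6): with `H₂ = ∅` no cluster meets `H₂`, the separation clause holds for EVERY `D`, and the two-hole expression vanishes identically — the bound
`e^{−D}·Σ_{H₁} a ≥ 0` is consistent.  Content-free; joint satisfiability of the displayed binders only. [folklore] -/
example (w : P → ℂ) (Λ H₁ : Finset P) :
    polymerLogZ inc w Λ - polymerLogZ inc w (Λ \ H₁) - polymerLogZ inc w (Λ \ ∅) + polymerLogZ inc w (Λ \ (H₁ ∪ ∅)) = 0 := by
  simp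

end Summit.QuantumFields.YangMills.BalabanUVNodes.N19MixingLetterOfTwoHoleDecoupling

end
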